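import Literature.NumberTheory.EllipticCurves.TorsionThreeConductorExponentTypeIVProofs
import Literature.NumberTheory.EllipticCurves.OggFormulaTameTypesTwoProofs
import Literature.NumberTheory.EllipticCurves.ShafarevichGoodReductionBadPlacesProofs
import Literature.NumberTheory.DiophantineGeometry.TateAlgorithmRingEquivProofs
import HarnessLib

/-!
# Crux `KobayashiLowerHalfLargeImage` (item stmt-BirchSwinnertonDyer-19001), line `shadow_seed`:
# the DYADIC shadow prime without a Tamagawa clause — `a_v(E[3]) = 1` at the place `v ∋ 2` of `E/ℚ`
# of Kodaira type `IV` or `IV*`, and `q ∥ N(ρ̄_{E,3})` at EVERY prime `q ≠ 3` of type `IV`/`IV*`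

HONEST FRAMING (D-0152). Route K3 = `SignedLowerHalves` is a CLASS route; crux 3 is the Eisenstein half of
Kobayashi's signed main conjecture on the large-image corner of X7. NOTHING here proves the crux, the
route, or BSD. This file is a HELPER of item 19001 (`--supports`). It composes two landed inputs:
`WeierstrassCurve.artinConductorAt_torsion_three_eq_one_of_isTameAt_of_kodairaSymbolAt` (w2 g8,
`TorsionThreeConductorExponentTypeIVProofs`: at a place `v ∤ 3` of type `IV`/`IV*`, `a_𝔓(E[3]) = 1` modulo
tameness, for EVERY value of `c_v`) and the tree's Ogg-at-`2` input
`WeierstrassCurve.forall_smul_geomTorsion_eq_of_kodairaSymbolAt_IV_or_IVstar_two`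
(`OggFormulaTameTypesTwoProofs`: over `ℚ`, at the place above `2` of type `IV`/`IV*`, the wild ramification
groups fix `E[ℓ]`, `ℓ` odd — good reduction over `ℚ₂(2^{1/3})`).  The sibling
`Theorems/…ShadowSerreLevelDyadic.lean` (w7 g2, p662248) proves the same value under `3 ∣ c_2`; here the
Tamagawa clause is gone.

* `isTameAt_torsionGaloisRep_of_kodairaSymbolAt_IV_or_IVstar_two` — `E[ℓ]` (`ℓ` odd) is tame at every
  `𝔓 ∣ 2` when the type at `2` is `IV` or `IV*`;
* **`artinConductorAt_torsion_three_eq_one_of_kodairaSymbolAt_two`,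
  `artinConductorExponent_torsion_three_eq_one_of_kodairaSymbolAt_two`** — `E/ℚ`, type `IV`/`IV*` at the
  place `v ∋ 2`: `a_𝔓(E[3]) = 1` for every `𝔓 ∣ v`, `a_v(E[3]) = 1` — NO hypothesis on `c_2`;
* **`Rat.artinConductorExponent_torsion_three_eq_one_of_kodairaSymbol_padic_of_ne_three`** — `E/ℚ`, ANY
  prime `q ≠ 3` with `(E.baseChange ℚ_[q]).kodairaSymbol ℤ_[q] ∈ {IV, IV*}`: `a_v(E[3]) = 1` at the place
  over `q` (`q = 2` by the above, `q ≥ 5` by `artinConductorExponent_torsion_three_eq_one_of_kodairaSymbolAt`)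
  — `q ∥ N(ρ̄_{E,3})` at EVERY shadow-type prime, both branches `c_q ∈ {1, 3}`.

Nothing is asserted about any particular curve; no modular form enters; BSD is not proved by any of this.

References: [SilvermanATAEC1994] §IV.10, Thm. IV.11.1 (`p = 2`), Table 4.1; [Serre1987] §1.2;
[DarmonDiamondTaylor1995] Lemma 2.7; [SerreLocalFields1979] Ch. VI §2.
-/

set_option linter.dupNamespace false

noncomputable section

open scoped Classical NumberField Pointwise
open Field IsDedekindDomain IsDedekindDomain.HeightOneSpectrum NumberField

universe u

namespace Summit.BirchSwinnertonDyer.BirchSwinnertonDyer.Theorems.ShadowConductor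

open Literature.NumberTheory.EllipticCurves Literature.NumberTheory.GaloisRepresentations
  Literature.NumberTheory.DiophantineGeometry WeierstrassCurve

variable (E : WeierstrassCurve ℚ) [E.IsElliptic]

/-- **`E[ℓ]` is tame above `2` at Kodaira type `IV`/`IV*` (`E/ℚ`, `ℓ` odd).**  The wild ramification
groups `Γ_ℚ^u(𝔓)`, `u > 0`, `𝔓 ∣ 2`, fix `E[ℓ]` pointwise
(`forall_smul_geomTorsion_eq_of_kodairaSymbolAt_IV_or_IVstar_two`: good reduction over the tame cubic
`ℚ₂(2^{1/3})`), i.e. act trivially on the representation `torsionGaloisRep`.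
[cite: SilvermanATAEC1994, Thm. IV.11.1, case p = 2 (PDF p. 366) and Table 4.1] -/
theorem isTameAt_torsionGaloisRep_of_kodairaSymbolAt_IV_or_IVstar_two
    {v : HeightOneSpectrum (𝓞 ℚ)} (hv : (2 : 𝓞 ℚ) ∈ v.asIdeal)
    (hT : E.kodairaSymbolAt v = .IV ∨ E.kodairaSymbolAt v = .IVstar)
    {ℓ : ℕ} (hℓ : (ℓ : 𝓞 ℚ) ∉ v.asIdeal)
    {𝔓 : Ideal (absIntegers (𝓞 ℚ) ℚ)} (h𝔓 : 𝔓 ∈ v.primesAbove) :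
    letI : Module (ZMod ℓ) (geomTorsion E (ℓ : ℕ)) := AddSubgroup.torsionBy.zmodModule
    (E.torsionGaloisRep ℓ).IsTameAt (𝓞 ℚ) 𝔓 := by
  letI : Module (ZMod ℓ) (geomTorsion E (ℓ : ℕ)) := AddSubgroup.torsionBy.zmodModule
  intro u hu σ hσ
  exact LinearMap.ext fun P ↦
    E.forall_smul_geomTorsion_eq_of_kodairaSymbolAt_IV_or_IVstar_two hv hT hℓ h𝔓 hu σ hσ P

/-- **`a_𝔓(E[3]) = 1` at the place above `2` of Kodaira type `IV` or `IV*`, for EVERY `c_2`** (`E/ℚ`,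
every `𝔓 ∣ 2`): `codim E[3]^{I_𝔓} = 1` (the line of `InertiaFixedTorsionTypeIVProofs`, through
`artinConductorAt_torsion_three_eq_one_of_isTameAt_of_kodairaSymbolAt`) and `Sw_𝔓(E[3]) = 0`
(`isTameAt_torsionGaloisRep_of_kodairaSymbolAt_IV_or_IVstar_two`).  The sibling
`ShadowSerreLevelDyadic.artinConductorAt_torsionGaloisRep_three_eq_one_of_two` has the extra hypothesis
`3 ∣ c_2`. [cite: SilvermanATAEC1994, Thm. IV.11.1 (p = 2) and Table 4.1 (PDF pp. 365–366)]
[cite: Serre1987, §1.2 (definition of N(ρ))] -/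
theorem artinConductorAt_torsion_three_eq_one_of_kodairaSymbolAt_two
    {v : HeightOneSpectrum (𝓞 ℚ)} (hv : (2 : 𝓞 ℚ) ∈ v.asIdeal)
    (hT : E.kodairaSymbolAt v = .IV ∨ E.kodairaSymbolAt v = .IVstar)
    {𝔓 : Ideal (absIntegers (𝓞 ℚ) ℚ)} (h𝔓 : 𝔓 ∈ v.primesAbove) :
    letI : Module (ZMod 3) (geomTorsion E (3 : ℕ)) := AddSubgroup.torsionBy.zmodModule
    (E.torsionGaloisRep 3).artinConductorAt (𝓞 ℚ) 𝔓 = 1 := by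
  have h3v : (3 : 𝓞 ℚ) ∉ v.asIdeal := three_not_mem_of_two_mem v hv
  exact E.artinConductorAt_torsion_three_eq_one_of_isTameAt_of_kodairaSymbolAt h3v hT h𝔓
    (isTameAt_torsionGaloisRep_of_kodairaSymbolAt_IV_or_IVstar_two E hv hT (by exact_mod_cast h3v) h𝔓)

/-- **`a_v(E[3]) = 1` at the place `v ∋ 2` of type `IV` or `IV*`, for EVERY `c_2`** (`E/ℚ`): the Serre
conductor exponent of `E[3]` at `2` is `1`, i.e. `2 ∥ N(ρ̄_{E,3})` — the dyadic shadow primes of line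
`shadow_seed` (type `IV` with `v_2(Δ) = 4` or `IV*` with `v_2(Δ) = 8`) whatever `c_2 ∈ {1, 3}`.
[cite: SilvermanATAEC1994, Thm. IV.11.1 (p = 2) and Table 4.1 (PDF pp. 365–366)]
[cite: Serre1987, §1.2 (definition of N(ρ))] -/
theorem artinConductorExponent_torsion_three_eq_one_of_kodairaSymbolAt_two
    {v : HeightOneSpectrum (𝓞 ℚ)} (hv : (2 : 𝓞 ℚ) ∈ v.asIdeal)
    (hT : E.kodairaSymbolAt v = .IV ∨ E.kodairaSymbolAt v = .IVstar) :
    letI : Module (ZMod 3) (geomTorsion E (3 : ℕ)) := AddSubgroup.torsionBy.zmodModule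
    (E.torsionGaloisRep 3).artinConductorExponent v = 1 := by
  have h3v : (3 : 𝓞 ℚ) ∉ v.asIdeal := three_not_mem_of_two_mem v hv
  obtain ⟨𝔓, h𝔓⟩ := primesAbove_nonempty v
  exact E.artinConductorExponent_torsion_three_eq_one_of_isTameAt_of_kodairaSymbolAt h3v hT h𝔓
    (isTameAt_torsionGaloisRep_of_kodairaSymbolAt_IV_or_IVstar_two E hv hT (by exact_mod_cast h3v) h𝔓)

section Rat

open Rat.HeightOneSpectrum

/-- `p ∈ v ↔ ℓ_v = p` / `p ∉ v` bookkeeping for a finite place `v` of `ℚ` and a prime `p` (Mathlib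
`Rat.HeightOneSpectrum.natGenerator_dvd_iff`); private plumbing. [folklore] -/
private theorem natCast_mem_asIdeal_iff_primesEquiv_eq' (v : HeightOneSpectrum (𝓞 ℚ)) {p : ℕ}
    (hp : p.Prime) : ((p : ℕ) : 𝓞 ℚ) ∈ v.asIdeal ↔ ((primesEquiv v : Nat.Primes) : ℕ) = p := by
  change _ ↔ natGenerator v = p
  rw [← Nat.prime_dvd_prime_iff_eq (prime_natGenerator v) hp, natGenerator_dvd_iff,
    ← map_natCast (Rat.IsIntegralClosure.intEquiv (𝓞 ℚ)) p, Ideal.apply_mem_of_equiv_iff]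

/-- **`q ∥ N(ρ̄_{E,3})` at EVERY prime `q ≠ 3` of Kodaira type `IV` or `IV*`** (`E/ℚ`; `ℤ_q`-type, the
currency of `ShadowSeed.IsShadowPrimeAt`; NO Tamagawa clause, NO valuation clause): the Serre conductor
exponent of `E[3]` at the place of `𝓞 ℚ` over `q` is `1` — `q = 2` by
`artinConductorExponent_torsion_three_eq_one_of_kodairaSymbolAt_two`, `q ≥ 5` by
`WeierstrassCurve.artinConductorExponent_torsion_three_eq_one_of_kodairaSymbolAt` (p664482), through
`kodairaSymbolAt_eq_padic`.
[cite: Serre1987, §1.2 (definition of N(ρ)) and §4] [cite: DarmonDiamondTaylor1995, Lemma 2.7 and Remark 2.14]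
[cite: SilvermanATAEC1994, Table 4.1 (PDF p. 365)] -/
theorem Rat.artinConductorExponent_torsion_three_eq_one_of_kodairaSymbol_padic_of_ne_three
    (v : HeightOneSpectrum (𝓞 ℚ)) {q : ℕ} [Fact q.Prime]
    (hv : ((primesEquiv v : Nat.Primes) : ℕ) = q) (hq3 : q ≠ 3)
    (hK : (E.baseChange ℚ_[q]).kodairaSymbol ℤ_[q] = .IV ∨
      (E.baseChange ℚ_[q]).kodairaSymbol ℤ_[q] = .IVstar) :
    letI : Module (ZMod 3) (geomTorsion E (3 : ℕ)) := AddSubgroup.torsionBy.zmodModule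
    (E.torsionGaloisRep 3).artinConductorExponent v = 1 := by
  have hq : q.Prime := Fact.out
  subst hv
  have hT : E.kodairaSymbolAt v = .IV ∨ E.kodairaSymbolAt v = .IVstar := by
    rw [kodairaSymbolAt_eq_padic v E]; exact hK
  by_cases h2 : ((primesEquiv v : Nat.Primes) : ℕ) = 2
  · have hv2 : ((2 : ℕ) : 𝓞 ℚ) ∈ v.asIdeal :=
      (natCast_mem_asIdeal_iff_primesEquiv_eq' v Nat.prime_two).mpr h2
    exact artinConductorExponent_torsion_three_eq_one_of_kodairaSymbolAt_two E (by exact_mod_cast hv2) hT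
  · have hn2 : ((2 : ℕ) : 𝓞 ℚ) ∉ v.asIdeal :=
      fun h ↦ h2 ((natCast_mem_asIdeal_iff_primesEquiv_eq' v Nat.prime_two).mp h)
    have hn3 : ((3 : ℕ) : 𝓞 ℚ) ∉ v.asIdeal :=
      fun h ↦ hq3 ((natCast_mem_asIdeal_iff_primesEquiv_eq' v Nat.prime_three).mp h)
    exact E.artinConductorExponent_torsion_three_eq_one_of_kodairaSymbolAt (by exact_mod_cast hn2)
      (by exact_mod_cast hn3) hT

end Rat

end Summit.BirchSwinnertonDyer.BirchSwinnertonDyer.Theorems.ShadowConductor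

end
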